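import Literature.Computability.Complexity.ExtMonotoneCircuits
import Literature.Computability.Complexity.ExtMonotoneGRankSupport
import Literature.Computability.Complexity.MonotoneSwitching
import Literature.Computability.Complexity.CliqueTestGraphs
import Literature.Computability.Complexity.CliqueCounting
import Literature.Computability.Complexity.ExtMonotoneCliqueGate
import Summits.PneNP.PneNP.Theorems.Capture.Negative.GateLocality
import Summits.PneNP.PneNP.Theorems.CliqueExtLowerBound.Negative.LoadBearing
import Mathlib

/-!
# Helpers for stub `stub_narrowAlgebraic` of line `width-threshold-certificate-sparsity`
(crux `CliqueExtLowerBound`, stmt-PneNP-10682)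

* SHORT MINTERMS of narrow algebraic gates (`exists_minterm_of_perm_or_grank`): a PERM or GRANK gate
  of width `≤ T` is monotone and every accepted input dominates an accepted indicator of at most
  `T (log₂ T + 1)` on-positions (tree: `IsPermGate.local` — strict subgroup chains, `2^#S ≤ T!`;
  `IsGRankGate.local` — one monomial of a `θ × θ` minor, `#S ≤ T`);
* integer sandwiches for `⌊m^e⌋₊`, `⌈m^e⌉₊` with `e * n = 1`;
* the two MASS LEMMAS of the referee pair: an exact clause `S` fails on at most a `D^{-#S}`
  fraction of the negatives (complements of `t`-sets of edge slots, `t D ≤ #slots`), an exact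
  monomial with more than `C(v,2)` edges holds on at most a `Q^{-v}` fraction of the positives
  (clique vectors of `k`-sets, `k Q ≤ m`);
* polynomial-versus-exponential numerics for the error budget `1 / (8 m^{c+1})`.
-/

set_option linter.dupNamespace false

open Literature.Computability.Complexity Filter Finset
open Summit.PneNP.PneNP.Theorems.CliqueExtLowerBound.Negative (eq_of_edges_subset)

namespace Summit.PneNP.PneNP.Theorems.CliqueExtLowerBound.WidthThreshold.NarrowAlgebraicHelpers

/-! ### Short minterms of narrow PERM / GRANK gates -/

/-- `2 ^ L ≤ T !` forces `L ≤ T (log₂ T + 1)` (`T ! ≤ T ^ T < 2 ^ {(log₂ T + 1) T}`). [folklore] -/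
theorem le_mul_log_of_two_pow_le_factorial {L T : ℕ} (h : 2 ^ L ≤ T.factorial) :
    L ≤ T * (Nat.log 2 T + 1) := by
  have h3 : 2 ^ L ≤ 2 ^ (T * (Nat.log 2 T + 1)) :=
    calc 2 ^ L ≤ T.factorial := h
      _ ≤ T ^ T := Nat.factorial_le_pow T
      _ ≤ (2 ^ (Nat.log 2 T + 1)) ^ T :=
          Nat.pow_le_pow_left (Nat.lt_pow_succ_log_self Nat.one_lt_two T).le T
      _ = 2 ^ (T * (Nat.log 2 T + 1)) := by rw [← pow_mul, Nat.mul_comm]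
  exact (Nat.pow_le_pow_iff_right Nat.one_lt_two).1 h3

/-- **Narrow algebraic gates have short minterms** (PERM or GRANK of width `≤ T`): the gate is
monotone and every accepted input dominates an accepted indicator of at most `T (log₂ T + 1)`
of its on-positions (`IsPermGate.local`, `IsGRankGate.local` of `GateLocality`). [folklore] -/
theorem exists_minterm_of_perm_or_grank {T : ℕ} {φ : GateFn}
    (h : IsPermGate T φ ∨ IsGRankGate T φ) :
    Monotone φ.2 ∧ ∀ v : Fin φ.1 → Bool, φ.2 v = true →
      ∃ S : Finset (Fin φ.1), #S ≤ T * (Nat.log 2 T + 1) ∧ (∀ i ∈ S, v i = true) ∧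
        φ.2 (fun i => decide (i ∈ S)) = true := by
  rcases h with h | h
  · refine ⟨h.monotone, fun v hv => ?_⟩
    obtain ⟨S, hS, h1, h2⟩ := Summit.PneNP.PneNP.Theorems.Capture.Negative.IsPermGate.local h v hv
    exact ⟨S, le_mul_log_of_two_pow_le_factorial hS, h1, h2⟩
  · refine ⟨h.monotone, fun v hv => ?_⟩
    obtain ⟨S, hS, h1, h2⟩ := Summit.PneNP.PneNP.Theorems.Capture.Negative.IsGRankGate.local h v hv
    exact ⟨S, hS.trans (Nat.le_mul_of_pos_right T (Nat.succ_pos _)), h1, h2⟩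

/-! ### Integer sandwiches -/

/-- `⌊m^e⌋₊ ^ n ≤ m` when `e n = 1`. [folklore] -/
theorem floor_rpow_pow_le (m n : ℕ) {e : ℝ} (he : e * n = 1) : (⌊(m : ℝ) ^ e⌋₊) ^ n ≤ m := by
  have h0 : (0 : ℝ) ≤ (m : ℝ) ^ e := Real.rpow_nonneg (Nat.cast_nonneg m) e
  have h2 : ((⌊(m : ℝ) ^ e⌋₊ : ℕ) : ℝ) ^ n ≤ ((m : ℝ) ^ e) ^ n :=
    pow_le_pow_left₀ (Nat.cast_nonneg _) (Nat.floor_le h0) n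
  rw [← Real.rpow_natCast ((m : ℝ) ^ e), ← Real.rpow_mul (Nat.cast_nonneg m), he,
    Real.rpow_one] at h2
  exact_mod_cast h2

/-- `m < (⌊m^e⌋₊ + 1) ^ n` when `e n = 1`. [folklore] -/
theorem lt_floor_rpow_add_one_pow (m n : ℕ) {e : ℝ} (he : e * n = 1) :
    m < (⌊(m : ℝ) ^ e⌋₊ + 1) ^ n := by
  have hn : n ≠ 0 := by rintro rfl; simp at he
  have h0 : (0 : ℝ) ≤ (m : ℝ) ^ e := Real.rpow_nonneg (Nat.cast_nonneg m) e
  have h2 : ((m : ℝ) ^ e) ^ n < (((⌊(m : ℝ) ^ e⌋₊ : ℕ) : ℝ) + 1) ^ n :=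
    pow_lt_pow_left₀ (Nat.lt_floor_add_one _) h0 hn
  rw [← Real.rpow_natCast ((m : ℝ) ^ e), ← Real.rpow_mul (Nat.cast_nonneg m), he,
    Real.rpow_one] at h2
  exact_mod_cast h2

/-- `m ≤ ⌈m^e⌉₊ ^ n` when `e n = 1`. [folklore] -/
theorem le_ceil_rpow_pow (m n : ℕ) {e : ℝ} (he : e * n = 1) : m ≤ (⌈(m : ℝ) ^ e⌉₊) ^ n := by
  have h0 : (0 : ℝ) ≤ (m : ℝ) ^ e := Real.rpow_nonneg (Nat.cast_nonneg m) e
  have h2 : ((m : ℝ) ^ e) ^ n ≤ ((⌈(m : ℝ) ^ e⌉₊ : ℕ) : ℝ) ^ n :=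
    pow_le_pow_left₀ h0 (Nat.le_ceil _) n
  rw [← Real.rpow_natCast ((m : ℝ) ^ e), ← Real.rpow_mul (Nat.cast_nonneg m), he,
    Real.rpow_one] at h2
  exact_mod_cast h2

/-- `(⌈m^e⌉₊ - 1) ^ n < m` when `e n = 1` and `m ≥ 1`. [folklore] -/
theorem ceil_rpow_sub_one_pow_lt {m : ℕ} (hm : 1 ≤ m) (n : ℕ) {e : ℝ} (he : e * n = 1) :
    (⌈(m : ℝ) ^ e⌉₊ - 1) ^ n < m := by
  have hn : n ≠ 0 := by rintro rfl; simp at he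
  have hpos : (0 : ℝ) < (m : ℝ) ^ e := Real.rpow_pos_of_pos (by exact_mod_cast hm) e
  have hk : 1 ≤ ⌈(m : ℝ) ^ e⌉₊ := Nat.ceil_pos.2 hpos
  have h1 : (((⌈(m : ℝ) ^ e⌉₊ - 1 : ℕ) : ℝ)) < (m : ℝ) ^ e := by
    rw [Nat.cast_sub hk, Nat.cast_one]
    linarith [Nat.ceil_lt_add_one hpos.le]
  have h2 : (((⌈(m : ℝ) ^ e⌉₊ - 1 : ℕ) : ℝ)) ^ n < ((m : ℝ) ^ e) ^ n :=
    pow_lt_pow_left₀ h1 (Nat.cast_nonneg _) hn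
  rw [← Real.rpow_natCast ((m : ℝ) ^ e), ← Real.rpow_mul (Nat.cast_nonneg m), he,
    Real.rpow_one] at h2
  exact_mod_cast h2

/-! ### Mass of an exact clause on the negatives -/

/-- **Negative mass lemma.** Among the complements `x_M` (`x_M e = 0 ↔ e ∈ M`) of the `t`-subsets
`M` of a finite set of slots with `t D ≤ #slots`, `D ≥ 1`, those falsifying the clause
`⋁_{e ∈ S} x_e` are the `M ⊇ S`, at most `C(#slots - #S, t - #S) ≤ C(#slots, t) / D^{#S}` of them
(`card_filter_supset_powersetCard_le`, `choose_sub_mul_pow_le`). [folklore] -/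
theorem card_filter_neg_mul_pow_le {E : Type*} [Fintype E] [DecidableEq E] {t Dd : ℕ}
    (hD : 1 ≤ Dd) (htD : t * Dd ≤ Fintype.card E) (g : Finset E → E → Bool)
    (hg : ∀ M e, g M e = false ↔ e ∈ M) (S : Finset E) (p : (E → Bool) → Prop)
    [DecidablePred p] (hp : ∀ x, p x → ¬ SatClause S x) :
    #(((powersetCard t (univ : Finset E)).image g).filter p) * Dd ^ #S ≤
      #((powersetCard t (univ : Finset E)).image g) := by
  have hginj : Function.Injective g := fun M M' h => by
    ext e
    rw [← hg M e, ← hg M' e, h]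
  rw [Finset.card_image_of_injective _ hginj, Finset.card_powersetCard, Finset.card_univ]
  have hsub : ((powersetCard t (univ : Finset E)).image g).filter p ⊆
      ((powersetCard t (univ : Finset E)).filter fun M => S ⊆ M).image g := by
    intro x hx
    rw [Finset.mem_filter, Finset.mem_image] at hx
    obtain ⟨⟨M, hM, rfl⟩, hpx⟩ := hx
    refine Finset.mem_image.2 ⟨M, Finset.mem_filter.2 ⟨hM, fun e he => ?_⟩, rfl⟩
    rw [← hg M e]
    cases hge : g M e
    · rfl
    · exact absurd ⟨e, he, hge⟩ (hp _ hpx)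
  by_cases hSt : #S ≤ t
  · calc #(((powersetCard t (univ : Finset E)).image g).filter p) * Dd ^ #S
        ≤ #(((powersetCard t (univ : Finset E)).filter fun M => S ⊆ M).image g) * Dd ^ #S :=
          Nat.mul_le_mul_right _ (Finset.card_le_card hsub)
      _ ≤ #((powersetCard t (univ : Finset E)).filter fun M => S ⊆ M) * Dd ^ #S :=
          Nat.mul_le_mul_right _ Finset.card_image_le
      _ ≤ (#(univ : Finset E) - #S).choose (t - #S) * Dd ^ #S :=
          Nat.mul_le_mul_right _ (card_filter_supset_powersetCard_le univ S hSt)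
      _ ≤ (Fintype.card E).choose t := by
          rw [Finset.card_univ]
          exact choose_sub_mul_pow_le hD hSt htD
  · have h0 : ((powersetCard t (univ : Finset E)).image g).filter p = ∅ := by
      refine Finset.eq_empty_of_forall_notMem fun x hx => hSt ?_
      obtain ⟨M, hM, -⟩ := Finset.mem_image.1 (hsub hx)
      rw [Finset.mem_filter, Finset.mem_powersetCard] at hM
      exact (Finset.card_le_card hM.2).trans hM.1.2.le
    rw [h0, Finset.card_empty, Nat.zero_mul]
    exact Nat.zero_le _

/-! ### Mass of an exact monomial on the positives -/

section Pos

variable {m : ℕ}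

/-- `cliqueVec` is injective on the `k`-subsets for `k ≥ 2`. [folklore] -/
theorem cliqueVec_injOn {k : ℕ} (hk : 2 ≤ k) :
    Set.InjOn (cliqueVec (m := m)) ↑(powersetCard k (univ : Finset (Fin m))) := by
  intro K hK K' hK' hKK'
  rw [Finset.mem_coe, Finset.mem_powersetCard] at hK hK'
  refine eq_of_edges_subset hk hK'.2 hK.2 fun e he => ?_
  have h1 := congrFun hKK' e
  simp only [cliqueVec] at h1
  have h2 : decide (∀ y ∈ (e : Sym2 (Fin m)), y ∈ K') = true := by
    rw [← h1]
    exact decide_eq_true he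
  exact of_decide_eq_true h2

/-- There are `C(m, k)` positive graphs (`k ≥ 2`). [folklore] -/
theorem card_posGraphs {k : ℕ} (hk : 2 ≤ k) : #(posGraphs m k) = m.choose k := by
  rw [posGraphs, Finset.card_image_of_injOn (cliqueVec_injOn hk), Finset.card_powersetCard,
    Finset.card_univ, Fintype.card_fin]

/-- A monomial `R` of edge slots holds on the clique vector of `K` iff all its edges lie inside
`K`, i.e. iff the vertices of `R` lie in `K`. [folklore] -/
theorem satTerm_cliqueVec_iff (R : Finset ((⊤ : SimpleGraph (Fin m)).edgeSet))
    (K : Finset (Fin m)) :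
    SatTerm R (cliqueVec K) ↔ edgeVerts (R.image Subtype.val) ⊆ K := by
  constructor
  · intro h
    refine edgeVerts_subset fun e he y hy => ?_
    obtain ⟨e', he', rfl⟩ := Finset.mem_image.1 he
    have := h e' he'
    simp only [cliqueVec, decide_eq_true_eq] at this
    exact this y hy
  · intro h e he
    simp only [cliqueVec, decide_eq_true_eq]
    exact fun y hy => h (mem_edgeVerts.2 ⟨e.1, Finset.mem_image_of_mem _ he, hy⟩)

/-- **Positive mass lemma.** Among the clique vectors of the `k`-subsets of `m` vertices
(`k ≥ 2`, `k Q ≤ m`, `Q ≥ 1`), those satisfying a monomial `R` with more than `C(v, 2)` edges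
are at most `C(m - v, k - v) ≤ C(m, k) / Q^v` (the edges of `R` touch at least `v` vertices,
all of which must lie in the `k`-set). [folklore] -/
theorem card_filter_pos_mul_pow_le {k Q v : ℕ} (hk : 2 ≤ k) (hQ : 1 ≤ Q) (hkQ : k * Q ≤ m)
    (R : Finset ((⊤ : SimpleGraph (Fin m)).edgeSet)) (hR : v.choose 2 < #R)
    (p : (((⊤ : SimpleGraph (Fin m)).edgeSet) → Bool) → Prop) [DecidablePred p]
    (hp : ∀ x, p x → SatTerm R x) :
    #((posGraphs m k).filter p) * Q ^ v ≤ #(posGraphs m k) := by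
  rw [card_posGraphs hk]
  have hR' : v.choose 2 < #(R.image Subtype.val) := by
    rwa [Finset.card_image_of_injective _ Subtype.val_injective]
  obtain ⟨V, hV, hVcard⟩ := Finset.exists_subset_card_eq (le_card_edgeVerts hR')
  have hsub : (posGraphs m k).filter p ⊆
      ((powersetCard k (univ : Finset (Fin m))).filter fun K => V ⊆ K).image cliqueVec := by
    intro x hx
    rw [Finset.mem_filter, posGraphs, Finset.mem_image] at hx
    obtain ⟨⟨K, hK, rfl⟩, hpx⟩ := hx
    exact Finset.mem_image.2 ⟨K, Finset.mem_filter.2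
      ⟨hK, hV.trans ((satTerm_cliqueVec_iff R K).1 (hp _ hpx))⟩, rfl⟩
  by_cases hvk : v ≤ k
  · calc #((posGraphs m k).filter p) * Q ^ v
        ≤ #(((powersetCard k (univ : Finset (Fin m))).filter fun K => V ⊆ K).image cliqueVec) *
            Q ^ v := Nat.mul_le_mul_right _ (Finset.card_le_card hsub)
      _ ≤ #((powersetCard k (univ : Finset (Fin m))).filter fun K => V ⊆ K) * Q ^ v :=
          Nat.mul_le_mul_right _ Finset.card_image_le
      _ ≤ (#(univ : Finset (Fin m)) - #V).choose (k - #V) * Q ^ v :=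
          Nat.mul_le_mul_right _ (card_filter_supset_powersetCard_le univ V (hVcard ▸ hvk))
      _ ≤ m.choose k := by
          rw [Finset.card_univ, Fintype.card_fin, hVcard]
          exact choose_sub_mul_pow_le hQ hvk hkQ
  · have h0 : (posGraphs m k).filter p = ∅ := by
      refine Finset.eq_empty_of_forall_notMem fun x hx => hvk ?_
      obtain ⟨K, hK, -⟩ := Finset.mem_image.1 (hsub hx)
      rw [Finset.mem_filter, Finset.mem_powersetCard] at hK
      rw [← hVcard]
      exact (Finset.card_le_card hK.2).trans hK.1.2.le
    rw [h0, Finset.card_empty, Nat.zero_mul]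
    exact Nat.zero_le _

end Pos

/-! ### Numerics -/

/-- Polynomial versus exponential: `C n^p ≤ 2^n` for all large `n`. [folklore] -/
theorem exists_mul_pow_le_two_pow (p C : ℕ) : ∃ n₀ : ℕ, ∀ n ≥ n₀, C * n ^ p ≤ 2 ^ n := by
  have h := tendsto_pow_const_div_const_pow_of_one_lt p (one_lt_two : (1 : ℝ) < 2)
  have hev : ∀ᶠ n : ℕ in atTop, (n : ℝ) ^ p / 2 ^ n < 1 / (C + 1) :=
    h.eventually (gt_mem_nhds (by positivity))
  obtain ⟨n₀, hn₀⟩ := Filter.eventually_atTop.1 hev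
  refine ⟨n₀, fun n hn => ?_⟩
  have h1 := hn₀ n hn
  rw [div_lt_div_iff₀ (by positivity) (by positivity), one_mul] at h1
  have h2 : (C : ℝ) * (n : ℝ) ^ p ≤ (n : ℝ) ^ p * (C + 1) := by
    nlinarith [pow_nonneg (Nat.cast_nonneg n : (0 : ℝ) ≤ n) p]
  exact_mod_cast h2.trans h1.le

/-- **Negative-side numerics.** With `T = ⌊m^{1/16}⌋₊`, `D = ⌊m^{1/8}⌋₊ ≥ T²`, `ρ ≥ 1` and
`s ≥ 16 (c + 3)`: eventually `8 m^{c+1} (T (log₂ T + 1) ρ)^s ≤ D^s` (the only non-polynomial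
ingredient is `(2 ρ (log₂ T + 1))^{c+2} ≤ T` for large `T`). [folklore] -/
theorem eventually_neg_numerics (c ρ s : ℕ) (hs : 16 * (c + 3) ≤ s) (hρ : 1 ≤ ρ) :
    ∀ᶠ m : ℕ in atTop, 8 * m ^ (c + 1) *
      (⌊(m : ℝ) ^ (1 / 16 : ℝ)⌋₊ * (Nat.log 2 ⌊(m : ℝ) ^ (1 / 16 : ℝ)⌋₊ + 1) * ρ) ^ s ≤
        ⌊(m : ℝ) ^ (1 / 8 : ℝ)⌋₊ ^ s := by
  obtain ⟨n₀, hn₀⟩ := exists_mul_pow_le_two_pow (c + 2) (2 * (2 * ρ) ^ (c + 2))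
  refine Filter.eventually_atTop.2 ⟨(2 ^ (n₀ + 1)) ^ 16, fun m hm => ?_⟩
  obtain ⟨s', rfl⟩ : ∃ s', s = 16 * (c + 1) + s' := ⟨s - 16 * (c + 1), by omega⟩
  have hs' : 32 ≤ s' := by omega
  set T := ⌊(m : ℝ) ^ (1 / 16 : ℝ)⌋₊ with hT
  set Dd := ⌊(m : ℝ) ^ (1 / 8 : ℝ)⌋₊ with hD
  have hmT : m < (T + 1) ^ 16 := lt_floor_rpow_add_one_pow m 16 (by norm_num)
  have hTm : T ^ 16 ≤ m := floor_rpow_pow_le m 16 (by norm_num)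
  have hmD : m < (Dd + 1) ^ 8 := lt_floor_rpow_add_one_pow m 8 (by norm_num)
  have hT1 : 2 ^ (n₀ + 1) ≤ T := by
    by_contra hlt
    push Not at hlt
    have : (T + 1) ^ 16 ≤ (2 ^ (n₀ + 1)) ^ 16 := Nat.pow_le_pow_left hlt 16
    omega
  have hTpos : 0 < T := lt_of_lt_of_le (Nat.two_pow_pos _) hT1
  have hTD : T ^ 2 ≤ Dd := by
    have h8 : (T ^ 2) ^ 8 < (Dd + 1) ^ 8 := by rw [← pow_mul]; exact lt_of_le_of_lt hTm hmD
    have := (Nat.pow_lt_pow_iff_left (by norm_num : (8 : ℕ) ≠ 0)).1 h8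
    omega
  set a := Nat.log 2 T with ha
  have ha1 : n₀ ≤ a + 1 := by
    have := Nat.le_log_of_pow_le Nat.one_lt_two hT1
    rw [← ha] at this
    omega
  have hkey : (2 * ρ * (a + 1)) ^ (c + 2) ≤ T := by
    have h1 := hn₀ (a + 1) ha1
    have h2 : 2 ^ a ≤ T := Nat.pow_log_le_self 2 hTpos.ne'
    have h3 : 2 * ((2 * ρ * (a + 1)) ^ (c + 2)) ≤ 2 * 2 ^ a := by
      calc 2 * ((2 * ρ * (a + 1)) ^ (c + 2)) = 2 * (2 * ρ) ^ (c + 2) * (a + 1) ^ (c + 2) := by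
            rw [mul_pow, mul_assoc]
        _ ≤ 2 ^ (a + 1) := h1
        _ = 2 * 2 ^ a := by rw [pow_succ']
    exact (Nat.le_of_mul_le_mul_left h3 Nat.two_pos).trans h2
  -- the main chain
  have hbase : 1 ≤ (a + 1) * ρ := Nat.one_le_iff_ne_zero.2 (Nat.mul_ne_zero (Nat.succ_ne_zero a)
    (by omega))
  have hKEY : 8 * m ^ (c + 1) * ((a + 1) * ρ) ^ (16 * (c + 1) + s') ≤ T ^ (16 * (c + 1) + s') := by
    calc 8 * m ^ (c + 1) * ((a + 1) * ρ) ^ (16 * (c + 1) + s')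
        ≤ 8 * ((2 * T) ^ 16) ^ (c + 1) * ((a + 1) * ρ) ^ (16 * (c + 1) + s') := by
          refine Nat.mul_le_mul_right _ (Nat.mul_le_mul_left 8 (Nat.pow_le_pow_left ?_ _))
          exact hmT.le.trans (Nat.pow_le_pow_left (by omega) 16)
      _ = 2 ^ (16 * (c + 1) + 3) * ((a + 1) * ρ) ^ (16 * (c + 1) + s') * T ^ (16 * (c + 1)) := by
          rw [mul_pow, mul_pow, ← pow_mul, ← pow_mul, pow_add 2]
          ring
      _ ≤ 2 ^ ((c + 2) * s') * ((a + 1) * ρ) ^ ((c + 2) * s') * T ^ (16 * (c + 1)) := by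
          refine Nat.mul_le_mul_right _ (Nat.mul_le_mul (Nat.pow_le_pow_right Nat.two_pos ?_)
            (Nat.pow_le_pow_right hbase ?_))
          · nlinarith
          · nlinarith
      _ = ((2 * ρ * (a + 1)) ^ (c + 2)) ^ s' * T ^ (16 * (c + 1)) := by
          rw [← mul_pow, ← pow_mul]
          ring
      _ ≤ T ^ s' * T ^ (16 * (c + 1)) := Nat.mul_le_mul_right _ (Nat.pow_le_pow_left hkey s')
      _ = T ^ (16 * (c + 1) + s') := by rw [← pow_add, add_comm]
  calc 8 * m ^ (c + 1) * (T * (a + 1) * ρ) ^ (16 * (c + 1) + s')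
      = 8 * m ^ (c + 1) * ((a + 1) * ρ) ^ (16 * (c + 1) + s') * T ^ (16 * (c + 1) + s') := by
        rw [mul_assoc T, mul_pow T]
        ring
    _ ≤ T ^ (16 * (c + 1) + s') * T ^ (16 * (c + 1) + s') := Nat.mul_le_mul_right _ hKEY
    _ = (T ^ 2) ^ (16 * (c + 1) + s') := by rw [← mul_pow, sq]
    _ ≤ Dd ^ (16 * (c + 1) + s') := Nat.pow_le_pow_left hTD _

/-- **Positive-side numerics.** With `k = ⌈m^{1/4}⌉₊` (so `m ≤ k⁴`, `(k-1)⁴ < m`), `m ≥ 17` and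
`m ≥ 8 (s-1)^r`: `k ≥ 2`, `Q := m / k ≥ 1` and `8 m^{c+1} (s-1)^r ≤ Q^{4(c+3)}` (as `Q ≥ k` and
`k⁴ ≥ m`). [folklore] -/
theorem pos_numerics {c r s m k : ℕ} (hm17 : 17 ≤ m) (hm : 8 * (s - 1) ^ r ≤ m) (hkm : m ≤ k ^ 4)
    (hk1m : (k - 1) ^ 4 < m) :
    2 ≤ k ∧ 1 ≤ m / k ∧ 8 * m ^ (c + 1) * (s - 1) ^ r ≤ (m / k) ^ (4 * (c + 3)) := by
  have hk3 : 3 ≤ k := by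
    by_contra h
    push Not at h
    have : k ^ 4 ≤ 2 ^ 4 := Nat.pow_le_pow_left (by omega) 4
    omega
  have hkk : k * k ≤ m := by
    obtain ⟨j, rfl⟩ : ∃ j, k = j + 3 := ⟨k - 3, by omega⟩
    have h1 : j + 3 ≤ (j + 2) ^ 2 := by nlinarith
    have h2 : (j + 3) * (j + 3) ≤ (j + 3 - 1) ^ 4 := by
      rw [show j + 3 - 1 = j + 2 by omega, show (j + 2) ^ 4 = (j + 2) ^ 2 * (j + 2) ^ 2 by ring]
      exact Nat.mul_le_mul h1 h1
    exact h2.trans hk1m.le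
  have hQ : k ≤ m / k := (Nat.le_div_iff_mul_le (by omega)).2 hkk
  refine ⟨by omega, le_trans (by omega) hQ, ?_⟩
  calc 8 * m ^ (c + 1) * (s - 1) ^ r = (8 * (s - 1) ^ r) * m ^ (c + 1) := by ring
    _ ≤ m * m ^ (c + 1) := Nat.mul_le_mul_right _ hm
    _ = m ^ (c + 2) := by rw [← pow_succ']
    _ ≤ m ^ (c + 3) := Nat.pow_le_pow_right (by omega) (by omega)
    _ ≤ (k ^ 4) ^ (c + 3) := Nat.pow_le_pow_left hkm _
    _ = k ^ (4 * (c + 3)) := by rw [← pow_mul]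
    _ ≤ (m / k) ^ (4 * (c + 3)) := Nat.pow_le_pow_left hQ _

/-- From `a · 8 m^{c+1} ≤ b` in `ℕ` to `a ≤ b / (8 m^{c+1})` in `ℝ` (`m ≥ 1`). [folklore] -/
theorem cast_le_eps_mul {a b m c : ℕ} (hm : 1 ≤ m) (h : a * (8 * m ^ (c + 1)) ≤ b) :
    (a : ℝ) ≤ 1 / (8 * (m : ℝ) ^ (c + 1)) * b := by
  have hpos : (0 : ℝ) < 8 * (m : ℝ) ^ (c + 1) := by
    have : (1 : ℝ) ≤ m := by exact_mod_cast hm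
    positivity
  rw [one_div, ← div_eq_inv_mul, le_div_iff₀ hpos]
  exact_mod_cast h

/-- REGISTERED SUB-GOAL (binder-free form of `exists_minterm_of_perm_or_grank`, the one genuinely
new ingredient of `stub_narrowAlgebraic`): narrow algebraic gates are monotone with short minterms.
[folklore] -/
theorem narrowAlgebraic_shortMinterms : ∀ (T : ℕ) (φ : GateFn), (IsPermGate T φ ∨ IsGRankGate T φ) →
    Monotone φ.2 ∧ ∀ v : Fin φ.1 → Bool, φ.2 v = true →
      ∃ S : Finset (Fin φ.1), #S ≤ T * (Nat.log 2 T + 1) ∧ (∀ i ∈ S, v i = true) ∧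
        φ.2 (fun i => decide (i ∈ S)) = true :=
  fun _ _ h => exists_minterm_of_perm_or_grank h

end Summit.PneNP.PneNP.Theorems.CliqueExtLowerBound.WidthThreshold.NarrowAlgebraicHelpers
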